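import Literature.NumberTheory.ComplexMultiplication.IrreducibleOddWeightsRightIdealsFree
import Literature.AlgebraicGeometry.ComplexMultiplication.IrreducibleOddWeightsProductSpanConverse
import Literature.NumberTheory.ComplexMultiplication.AbelianCMFamilyRankCharacters
import HarnessLib

/-!
# Right ideals, II: CM fields — `dim MT(∏_i A_i) = 1 + dim Σ_i MC_i` with the matrix coefficients read on `Gal(L/ℚ)`;
# the exact defect `Σ_i dim Hg(A_i) − dim Hg(∏_i A_i)`, additivity iff `iSupIndep`, and the Hodge side

COR-CM (cell `pub-hodgecm2`, binder seat `b16` gen 64, count-neutral claim RIGHT IDEALS, file R2 — CM-field dress of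
R1/R1b `IrreducibleOddWeightsRightIdeals{,Free}`; theorems only, no definition, no named fact, no `sorry`).  NEW as
stated, hence under `Summits/`.  HONEST FRAMING: exact formulas for the dimension of the Mumford–Tate group of a product
of abelian varieties with complex multiplication in terms of finitely many explicit `±1`-vectors on a Galois group, and
their reading on Hodge classes of products through the tree's Moonen–Zarhin equivalence; `HC_CM` is neither used nor
asserted.

SETTING.  CM fields `K_i` (`i ∈ I` finite), CM types `Φ_i`, realisations `A_i ⊨ (K_i; Φ_i)`; a number field `L`
NORMAL over `ℚ` receiving every `K_i` (`e_i : K_i → L`), `ι : L → ℂ`, `G = Gal(L/ℚ)`.  For an `L`-valued embedding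
`x : K_i → L` the MATRIX COEFFICIENT `c_{i,x} : G → {±1}`, `c_{i,x}(g) = +1` iff `ι ∘ g ∘ x ∈ Φ_i`; the matrix-coefficient
space `MC_i = span_ℚ{c_{i,x} : x ∈ Hom(K_i, L)} ≤ ℚ^G` (`= u_i·ℚ[G]`, the RIGHT ideal generated by the induced type
vector, R1b; `= X^*(MT(A_i))_ℚ`).  `dim MT = cmFamilyRank` / `cmTypeRank` (Deligne's Ex. 3.7, the tree's currency).

* §1 `finrank_iSup_span_coeff_complex_eq` — TRANSPORT: the matrix coefficients on `Aut(ℂ)` (R1 with `G = Aut(ℂ)`) are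
  the pull-backs of the `c_{i,x}` along the restriction `Aut(ℂ) → Gal(L/ℚ)` (surjective), so all dimensions may be
  computed on the finite group.
* §2 **`cmFamilyRank_eq_finrank_iSup_span_coeff_add_one`** — **`dim MT(∏_i A_i) = 1 + dim Σ_i MC_i`**: ONE rank
  computation on `Σ_i [K_i:ℚ]` explicit vectors of length `|G|`; **`cmTypeRank_eq_finrank_span_coeff_add_one`** —
  `dim MT(A_i) = 1 + dim MC_i`.
* §3 THE EXACT DEFECT: **`cmFamilyRank_add_card_add_sum_finrank_eq`** — `Σ_i dim Hg(A_i) − dim Hg(∏_i A_i) =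
  Σ_i dim MC_i − dim Σ_i MC_i`; **`cmFamilyRank_add_card_eq_iff_iSupIndep`** — `Hg(∏_i A_i) = ∏_i Hg(A_i)` IFF the
  `MC_i` are INDEPENDENT subspaces of `ℚ^G` (the quantitative form of gen 54's `CommonCoefficientCMFields`);
  **`cmTypeRank_add_cmTypeRank_eq_of_pair`** — `dim Hg(A₀) + dim Hg(A₁) − dim Hg(A₀ × A₁) = dim(MC₀ ∩ MC₁)`.
* §4 HODGE SIDE (tree `cmFamilyRank_add_card_eq_iff_forall_hodgeClassesProductSpan`, Moonen–Zarhin (3.1)):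
  **`forall_hodgeClassesProductSpan_iff_iSupIndep`** — every Hodge class on every product `(⨁ A_{π₁ l}) × (⨁ A_{π₂ l})`
  with disjoint slot maps is a sum of products of Hodge classes IFF the `MC_i` are independent;
  `exists_not_hodgeClassesProductSpan_of_not_iSupIndep` — a dependence produces a MIXED exceptional Hodge class;
  pair forms with `MC₀ ⊓ MC₁`.

## References

* [Deligne1982HodgeCycles] P. Deligne, *Hodge cycles on abelian varieties*, LNM 900 (1982), I.3.4, I.5 (p. 53), I Ex. 3.7.
* [Ribet1980] K. A. Ribet, *Division fields of abelian varieties with complex multiplication*, Mém. SMF 2 (1980), §3 (3.3).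
* [Shimura1998] G. Shimura, *Abelian Varieties with Complex Multiplication and Modular Functions*, §8.1.
* [MoonenZarhin1999LowDim] B. Moonen, Yu. Zarhin, *Hodge classes on abelian varieties of low dimension*, §3 (3.1).
* [Gordon1999HodgeAVSurvey] B. B. Gordon, *A survey of the Hodge conjecture for abelian varieties*, §3, 7.5–7.7, 9.1.

Provenance: Literature home (namespace `Literature.AlgebraicGeometry.ComplexMultiplication.IrreducibleOddWeightsRightIdealsCMFields`) of the Summits-side `CorCM/IrreducibleOddWeightsRightIdealsCMFields` (cell `pub-hodgecm2`, COR-CM; all its imports are `Literature/`, Mathlib and the already re-homed `IrreducibleOddWeightsRightIdealsFree`, `IrreducibleOddWeightsProductSpanConverse`), which `Literature/` may not import; theorems only, no named fact, no definition. Nothing here bears on `HC_CM`. Lane `lit-hodgefound` (Layer A3: CM types, their Kubota ranks and Galois combinatorics), seat p20.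
-/

set_option autoImplicit false

noncomputable section

open scoped BigOperators

open _root_.CategoryTheory _root_.CategoryTheory.Limits NumberField Module

namespace Literature.AlgebraicGeometry.ComplexMultiplication.IrreducibleOddWeightsRightIdealsCMFields

open Literature.NumberTheory.ComplexMultiplication.IrrOdd Literature.NumberTheory.ComplexMultiplication Literature.AlgebraicGeometry.ComplexMultiplication.IrreducibleOddWeightsProductSpanConverse Literature.AlgebraicGeometry.ComplexMultiplication.IrreducibleOddWeightsProductSpan

open Literature.NumberTheory.ComplexMultiplication
open Literature.AlgebraicGeometry.Motives (AbelianVariety CMType)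
open Literature.AlgebraicGeometry.Motives.AbelianVariety
open Literature.AlgebraicGeometry.HodgeTheory
open Literature.AlgebraicGeometry.ComplexMultiplication (IsCMTypeRealisation)
open Literature.AlgebraicGeometry.Pohlmann1968

/-! ### §1 Transport of the matrix coefficients from `Aut(ℂ)` to `Gal(L/ℚ)` -/

section Transport

variable {I : Type} {K : I → Type} [∀ i, Field (K i)] [∀ i, NumberField (K i)]
  {L : Type} [Field L] [NumberField L] [Normal ℚ L]

omit [∀ i, NumberField (K i)] [Normal ℚ L] in
/-- Matrix coefficients on `Aut(ℂ)` are pull-backs from `Gal(L/ℚ)`: with `τ ∘ ι = ι ∘ r(τ)` and `t = ι ∘ x`,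
`u_1(Φ)(τ·t) = c_x(r τ)`. [cite: Shimura1998, §8.1] -/
theorem antiVec_ringEquiv_comp_eq (ι : L →+* ℂ) {i : I} (Φ : CMType (K i)) (x : K i →+* L) {τ : ℂ ≃+* ℂ}
    {γ : L ≃ₐ[ℚ] L} (hγ : ∀ y, τ (ι y) = ι (γ y)) :
    antiVec Φ.1 τ (ι.comp x) = antiVec Φ.1 (1 : ℂ ≃+* ℂ) ((ι.comp (γ : L →+* L)).comp x) := by
  rw [IrrOdd.antiVec_apply_eq_antiVec_one_smul]
  congr 1
  refine RingHom.ext fun y => ?_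
  rw [ringEquiv_smul_apply, RingHom.comp_apply, hγ]
  rfl

/-- **TRANSPORT.**  The span of the matrix coefficients of the members on `Aut(ℂ)` is the pull-back, along the
(surjective) restriction `Aut(ℂ) → Gal(L/ℚ)`, of the span of the matrix coefficients `c_{i,x}` (`x ∈ Hom(K_i, L)`) on
`Gal(L/ℚ)`; in particular `dim ⨆_i MC_i` and `dim(MC_{i₀} ∩ MC_{i₁})` may be computed on the finite group.
[cite: Shimura1998, §8.1] [cite: Deligne1982HodgeCycles, I.3.4] -/
theorem exists_funLeft_map_span_coeff_eq (ι : L →+* ℂ) (e : ∀ i, K i →+* L) (Φ : ∀ i, CMType (K i)) :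
    ∃ r : (ℂ ≃+* ℂ) → (L ≃ₐ[ℚ] L), Function.Surjective r ∧ ∀ i,
      Submodule.span ℚ (Set.range fun t : K i →+* ℂ => fun τ : ℂ ≃+* ℂ => antiVec (Φ i).1 τ t) =
        (Submodule.span ℚ (Set.range fun x : K i →+* L => fun g : L ≃ₐ[ℚ] L =>
          antiVec (Φ i).1 (1 : ℂ ≃+* ℂ) ((ι.comp (g : L →+* L)).comp x))).map
          (LinearMap.funLeft ℚ ℚ r) := by
  choose r hr using fun τ : ℂ ≃+* ℂ => exists_algEquiv_comp_eq_smul ι τ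
  have hsurj : Function.Surjective r := by
    intro g
    obtain ⟨τ, hτ⟩ := exists_ringEquiv_comp_eq_algEquiv ι g
    refine ⟨τ, AlgEquiv.ext fun y => ι.injective ?_⟩
    rw [← hr τ y, hτ y]
  refine ⟨r, hsurj, fun i => ?_⟩
  rw [← Submodule.span_image, ← Set.range_comp]
  congr 1
  ext c
  simp only [Set.mem_range, Function.comp_apply]
  constructor
  · rintro ⟨t, rfl⟩
    obtain ⟨g, rfl⟩ := exists_eq_comp_algEquiv_comp ι e i t
    refine ⟨(g : L →+* L).comp (e i), funext fun τ => ?_⟩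
    rw [LinearMap.funLeft_apply]
    exact (antiVec_ringEquiv_comp_eq ι (Φ i) ((g : L →+* L).comp (e i)) (hr τ)).symm
  · rintro ⟨x, rfl⟩
    refine ⟨ι.comp x, funext fun τ => ?_⟩
    rw [LinearMap.funLeft_apply]
    exact antiVec_ringEquiv_comp_eq ι (Φ i) x (hr τ)

/-- `dim ⨆_i MC_i` computed on `Aut(ℂ)` equals `dim ⨆_i MC_i` computed on `Gal(L/ℚ)`. [cite: Shimura1998, §8.1] -/
theorem finrank_iSup_span_coeff_complex_eq (ι : L →+* ℂ) (e : ∀ i, K i →+* L) (Φ : ∀ i, CMType (K i)) :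
    Module.finrank ℚ (⨆ i, Submodule.span ℚ (Set.range fun t : K i →+* ℂ => fun τ : ℂ ≃+* ℂ =>
        antiVec (Φ i).1 τ t) : Submodule ℚ ((ℂ ≃+* ℂ) → ℚ)) =
      Module.finrank ℚ (⨆ i, Submodule.span ℚ (Set.range fun x : K i →+* L => fun g : L ≃ₐ[ℚ] L =>
        antiVec (Φ i).1 (1 : ℂ ≃+* ℂ) ((ι.comp (g : L →+* L)).comp x)) : Submodule ℚ ((L ≃ₐ[ℚ] L) → ℚ)) := by
  obtain ⟨r, hr, h⟩ := exists_funLeft_map_span_coeff_eq ι e Φ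
  rw [show (⨆ i, Submodule.span ℚ (Set.range fun t : K i →+* ℂ => fun τ : ℂ ≃+* ℂ => antiVec (Φ i).1 τ t)) =
      (⨆ i, Submodule.span ℚ (Set.range fun x : K i →+* L => fun g : L ≃ₐ[ℚ] L =>
        antiVec (Φ i).1 (1 : ℂ ≃+* ℂ) ((ι.comp (g : L →+* L)).comp x))).map (LinearMap.funLeft ℚ ℚ r) from by
    rw [Submodule.map_iSup]; exact iSup_congr h]
  exact (LinearEquiv.finrank_eq
    (Submodule.equivMapOfInjective _ (LinearMap.funLeft_injective_of_surjective ℚ ℚ r hr) _)).symm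

/-- `dim(MC_{i₀} ∩ MC_{i₁})` computed on `Aut(ℂ)` equals the same on `Gal(L/ℚ)`. [cite: Shimura1998, §8.1] -/
theorem finrank_inf_span_coeff_complex_eq (ι : L →+* ℂ) (e : ∀ i, K i →+* L) (Φ : ∀ i, CMType (K i)) (i₀ i₁ : I) :
    Module.finrank ℚ (Submodule.span ℚ (Set.range fun t : K i₀ →+* ℂ => fun τ : ℂ ≃+* ℂ => antiVec (Φ i₀).1 τ t) ⊓
        Submodule.span ℚ (Set.range fun t : K i₁ →+* ℂ => fun τ : ℂ ≃+* ℂ => antiVec (Φ i₁).1 τ t) :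
          Submodule ℚ ((ℂ ≃+* ℂ) → ℚ)) =
      Module.finrank ℚ (Submodule.span ℚ (Set.range fun x : K i₀ →+* L => fun g : L ≃ₐ[ℚ] L =>
          antiVec (Φ i₀).1 (1 : ℂ ≃+* ℂ) ((ι.comp (g : L →+* L)).comp x)) ⊓
        Submodule.span ℚ (Set.range fun x : K i₁ →+* L => fun g : L ≃ₐ[ℚ] L =>
          antiVec (Φ i₁).1 (1 : ℂ ≃+* ℂ) ((ι.comp (g : L →+* L)).comp x)) : Submodule ℚ ((L ≃ₐ[ℚ] L) → ℚ)) := by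
  obtain ⟨r, hr, h⟩ := exists_funLeft_map_span_coeff_eq ι e Φ
  have hinj := LinearMap.funLeft_injective_of_surjective ℚ ℚ r hr
  rw [h i₀, h i₁, ← Submodule.map_inf _ hinj]
  exact (LinearEquiv.finrank_eq (Submodule.equivMapOfInjective _ hinj _)).symm

/-- `dim MC_i` computed on `Aut(ℂ)` equals `dim MC_i` on `Gal(L/ℚ)`. [cite: Shimura1998, §8.1] -/
theorem finrank_span_coeff_complex_eq (ι : L →+* ℂ) (e : ∀ i, K i →+* L) (Φ : ∀ i, CMType (K i)) (i : I) :
    Module.finrank ℚ (Submodule.span ℚ (Set.range fun t : K i →+* ℂ => fun τ : ℂ ≃+* ℂ => antiVec (Φ i).1 τ t)) =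
      Module.finrank ℚ (Submodule.span ℚ (Set.range fun x : K i →+* L => fun g : L ≃ₐ[ℚ] L =>
        antiVec (Φ i).1 (1 : ℂ ≃+* ℂ) ((ι.comp (g : L →+* L)).comp x))) := by
  obtain ⟨r, hr, h⟩ := exists_funLeft_map_span_coeff_eq ι e Φ
  rw [h i]
  exact (LinearEquiv.finrank_eq
    (Submodule.equivMapOfInjective _ (LinearMap.funLeft_injective_of_surjective ℚ ℚ r hr) _)).symm

end Transport

/-! ### §2 `dim MT(∏_i A_i) = 1 + dim Σ_i MC_i` -/

section Rank

variable {I : Type} [Fintype I] {K : I → Type} [∀ i, Field (K i)] [∀ i, NumberField (K i)] [∀ i, IsCMField (K i)]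
  {L : Type} [Field L] [NumberField L] [Normal ℚ L]

omit [Fintype I] [∀ i, IsCMField (K i)] [Normal ℚ L] in
/-- The matrix-coefficient space on `Gal(L/ℚ)` is finite-dimensional. [cite: Shimura1998, §8.1] -/
theorem finite_span_coeff_gal (ι : L →+* ℂ) {i : I} (Φ : CMType (K i)) :
    Module.Finite ℚ (Submodule.span ℚ (Set.range fun x : K i →+* L => fun g : L ≃ₐ[ℚ] L =>
      antiVec Φ.1 (1 : ℂ ≃+* ℂ) ((ι.comp (g : L →+* L)).comp x))) :=
  Module.Finite.span_of_finite ℚ (Set.finite_range _)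

/-- **`dim MT(∏_i A_i) = 1 + dim Σ_i MC_i`.**  For CM fields `K_i` with CM types `Φ_i`, all received by a normal
number field `L` (`ι : L → ℂ`): `cmFamilyRank Φ` (`= dim MT(∏_i A_{Φ_i})`) is one plus the dimension of the span, in
`ℚ^{Gal(L/ℚ)}`, of the `±1`-vectors `c_{i,x} : g ↦ [ι∘g∘x ∈ Φ_i]±`, `i ∈ I`, `x ∈ Hom(K_i, L)` — the characters of
`MT(∏_i A_i)`, i.e. the SUM of the RIGHT ideals generated by the induced type vectors in `ℚ[Gal(L/ℚ)]`.
[cite: Deligne1982HodgeCycles, I.3.4, I.5 (p. 53) and I Ex. 3.7] [cite: Ribet1980, §3 (3.3)] [cite: Shimura1998, §8.1] -/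
theorem cmFamilyRank_eq_finrank_iSup_span_coeff_add_one [Nonempty I] (ι : L →+* ℂ) (e : ∀ i, K i →+* L)
    (Φ : ∀ i, CMType (K i)) :
    CMAlgebra.cmFamilyRank Φ =
      Module.finrank ℚ (⨆ i, Submodule.span ℚ (Set.range fun x : K i →+* L => fun g : L ≃ₐ[ℚ] L =>
        antiVec (Φ i).1 (1 : ℂ ≃+* ℂ) ((ι.comp (g : L →+* L)).comp x)) : Submodule ℚ ((L ≃ₐ[ℚ] L) → ℚ)) + 1 := by
  obtain ⟨i₀⟩ := ‹Nonempty I›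
  haveI : Nonempty (Σ i, (K i →+* ℂ)) := ⟨⟨i₀, Classical.arbitrary _⟩⟩
  have h1 : CMAlgebra.cmFamilyRank Φ =
      Module.finrank ℚ (antiSpan (ℂ ≃+* ℂ) (sigmaType fun i => (Φ i).1)) + 1 :=
    (IsCMTypeWith.sigmaType fun i => isCMTypeWith_conj (Φ i)).typeRank_eq_finrank_antiSpan_add_one
  rw [h1, IrrOdd.finrank_antiSpan_sigmaType_eq_finrank_iSup_span_coeff, finrank_iSup_span_coeff_complex_eq ι e Φ]

omit [Fintype I] in
/-- **`dim MT(A_i) = 1 + dim MC_i`** — one member: `cmTypeRank Φ_i` is one plus the dimension of the span of the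
`c_{i,x}`, `x ∈ Hom(K_i, L)` (the right ideal `u_iℚ[Gal(L/ℚ)]`, of the same dimension as the left ideal of translates).
[cite: Ribet1980, §3 (3.3)] [cite: Shimura1998, §8.1] -/
theorem cmTypeRank_eq_finrank_span_coeff_add_one (ι : L →+* ℂ) (e : ∀ i, K i →+* L) (Φ : ∀ i, CMType (K i))
    (i : I) :
    cmTypeRank (Φ i) =
      Module.finrank ℚ (Submodule.span ℚ (Set.range fun x : K i →+* L => fun g : L ≃ₐ[ℚ] L =>
        antiVec (Φ i).1 (1 : ℂ ≃+* ℂ) ((ι.comp (g : L →+* L)).comp x))) + 1 := by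
  have h1 : cmTypeRank (Φ i) = Module.finrank ℚ (antiSpan (ℂ ≃+* ℂ) (Φ i).1) + 1 :=
    (isCMTypeWith_conj (Φ i)).typeRank_eq_finrank_antiSpan_add_one
  rw [h1, IrrOdd.finrank_antiSpan_eq_finrank_span_coeff, finrank_span_coeff_complex_eq ι e Φ i]

/-! ### §3 The exact defect -/

/-- **THE EXACT DEFECT `Σ_i dim Hg(A_i) − dim Hg(∏_i A_i) = Σ_i dim MC_i − dim Σ_i MC_i`**, written additively:
`cmFamilyRank Φ + |I| + Σ_i dim MC_i = Σ_i cmTypeRank Φ_i + 1 + dim(⨆_i MC_i)`.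
[cite: Deligne1982HodgeCycles, I.5 (p. 53)] [cite: Gordon1999HodgeAVSurvey, §3 Theorem (proof) and 7.7] -/
theorem cmFamilyRank_add_card_add_sum_finrank_eq [Nonempty I] (ι : L →+* ℂ) (e : ∀ i, K i →+* L)
    (Φ : ∀ i, CMType (K i)) :
    CMAlgebra.cmFamilyRank Φ + Fintype.card I +
        ∑ i, Module.finrank ℚ (Submodule.span ℚ (Set.range fun x : K i →+* L => fun g : L ≃ₐ[ℚ] L =>
          antiVec (Φ i).1 (1 : ℂ ≃+* ℂ) ((ι.comp (g : L →+* L)).comp x))) =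
      (∑ i, cmTypeRank (Φ i)) + 1 +
        Module.finrank ℚ (⨆ i, Submodule.span ℚ (Set.range fun x : K i →+* L => fun g : L ≃ₐ[ℚ] L =>
          antiVec (Φ i).1 (1 : ℂ ≃+* ℂ) ((ι.comp (g : L →+* L)).comp x)) : Submodule ℚ ((L ≃ₐ[ℚ] L) → ℚ)) := by
  rw [cmFamilyRank_eq_finrank_iSup_span_coeff_add_one ι e Φ,
    Finset.sum_congr rfl fun i _ => cmTypeRank_eq_finrank_span_coeff_add_one ι e Φ i, Finset.sum_add_distrib,
    Finset.sum_const, Finset.card_univ, smul_eq_mul, mul_one]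
  omega

/-- **`Hg(∏_i A_i) = ∏_i Hg(A_i)` IFF THE MATRIX-COEFFICIENT SPACES `MC_i ≤ ℚ^{Gal(L/ℚ)}` ARE INDEPENDENT** (the
quantitative reading of gen 54's common-coefficient criterion: in general the defect is `Σ dim MC_i − dim Σ MC_i`).
[cite: Gordon1999HodgeAVSurvey, §3 Theorem and 7.5–7.7] [cite: Deligne1982HodgeCycles, I.5 (p. 53)] -/
theorem cmFamilyRank_add_card_eq_iff_iSupIndep [Nonempty I] (ι : L →+* ℂ) (e : ∀ i, K i →+* L)
    (Φ : ∀ i, CMType (K i)) :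
    CMAlgebra.cmFamilyRank Φ + Fintype.card I = (∑ i, cmTypeRank (Φ i)) + 1 ↔
      iSupIndep fun i => Submodule.span ℚ (Set.range fun x : K i →+* L => fun g : L ≃ₐ[ℚ] L =>
        antiVec (Φ i).1 (1 : ℂ ≃+* ℂ) ((ι.comp (g : L →+* L)).comp x)) := by
  haveI := fun i => finite_span_coeff_gal ι (Φ i)
  rw [← IrrOdd.finrank_iSup_eq_sum_finrank_iff_iSupIndep]
  have := cmFamilyRank_add_card_add_sum_finrank_eq ι e Φ
  omega

omit [Fintype I] in
/-- **THE PAIR DEFECT `dim Hg(A₀) + dim Hg(A₁) − dim Hg(A₀ × A₁) = dim(MC₀ ∩ MC₁)`** (`I = {i₀, i₁}`): the codimension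
of `Hg(A₀ × A₁)` in `Hg(A₀) × Hg(A₁)` is the dimension of the space of common matrix coefficients on `Gal(L/ℚ)`.
[cite: Gordon1999HodgeAVSurvey, §3 Theorem (proof) and 7.5–7.7] [cite: Deligne1982HodgeCycles, I.5 (p. 53)] -/
theorem cmTypeRank_add_cmTypeRank_eq_of_pair [Fintype I] (ι : L →+* ℂ) (e : ∀ i, K i →+* L)
    (Φ : ∀ i, CMType (K i)) {i₀ i₁ : I} (hI : ∀ j, j = i₀ ∨ j = i₁) (h01 : i₀ ≠ i₁) :
    cmTypeRank (Φ i₀) + cmTypeRank (Φ i₁) = CMAlgebra.cmFamilyRank Φ + 1 +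
      Module.finrank ℚ (Submodule.span ℚ (Set.range fun x : K i₀ →+* L => fun g : L ≃ₐ[ℚ] L =>
          antiVec (Φ i₀).1 (1 : ℂ ≃+* ℂ) ((ι.comp (g : L →+* L)).comp x)) ⊓
        Submodule.span ℚ (Set.range fun x : K i₁ →+* L => fun g : L ≃ₐ[ℚ] L =>
          antiVec (Φ i₁).1 (1 : ℂ ≃+* ℂ) ((ι.comp (g : L →+* L)).comp x)) : Submodule ℚ ((L ≃ₐ[ℚ] L) → ℚ)) := by
  haveI : Nonempty I := ⟨i₀⟩
  haveI := fun i => finite_span_coeff_gal ι (Φ i)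
  have hdef := cmFamilyRank_add_card_add_sum_finrank_eq ι e Φ
  have hcard : Fintype.card I = 2 := by
    classical
    rw [← Finset.card_univ, show (Finset.univ : Finset I) = {i₀, i₁} from Finset.ext fun j => by
      simpa only [Finset.mem_univ, Finset.mem_insert, Finset.mem_singleton, true_iff] using hI j,
      Finset.card_pair h01]
  rw [IrrOdd.iSup_eq_sup_of_pair _ hI, IrrOdd.sum_eq_add_of_pair _ hI h01, IrrOdd.sum_eq_add_of_pair _ hI h01, hcard]
    at hdef
  have hsup := Submodule.finrank_sup_add_finrank_inf_eq
    (Submodule.span ℚ (Set.range fun x : K i₀ →+* L => fun g : L ≃ₐ[ℚ] L =>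
      antiVec (Φ i₀).1 (1 : ℂ ≃+* ℂ) ((ι.comp (g : L →+* L)).comp x)))
    (Submodule.span ℚ (Set.range fun x : K i₁ →+* L => fun g : L ≃ₐ[ℚ] L =>
      antiVec (Φ i₁).1 (1 : ℂ ≃+* ℂ) ((ι.comp (g : L →+* L)).comp x)))
  omega

omit [Fintype I] in
/-- **`Hg(A₀ × A₁) = Hg(A₀) × Hg(A₁)` iff `MC₀ ∩ MC₁ = 0` on `Gal(L/ℚ)`.** [cite: Gordon1999HodgeAVSurvey, §3 Theorem and 7.5–7.7] -/
theorem cmFamilyRank_add_card_eq_iff_inf_eq_bot_of_pair [Fintype I] (ι : L →+* ℂ) (e : ∀ i, K i →+* L)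
    (Φ : ∀ i, CMType (K i)) {i₀ i₁ : I} (hI : ∀ j, j = i₀ ∨ j = i₁) (h01 : i₀ ≠ i₁) :
    CMAlgebra.cmFamilyRank Φ + Fintype.card I = (∑ i, cmTypeRank (Φ i)) + 1 ↔
      Submodule.span ℚ (Set.range fun x : K i₀ →+* L => fun g : L ≃ₐ[ℚ] L =>
          antiVec (Φ i₀).1 (1 : ℂ ≃+* ℂ) ((ι.comp (g : L →+* L)).comp x)) ⊓
        Submodule.span ℚ (Set.range fun x : K i₁ →+* L => fun g : L ≃ₐ[ℚ] L =>
          antiVec (Φ i₁).1 (1 : ℂ ≃+* ℂ) ((ι.comp (g : L →+* L)).comp x)) = (⊥ : Submodule ℚ ((L ≃ₐ[ℚ] L) → ℚ)) := by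
  haveI : Nonempty I := ⟨i₀⟩
  haveI := fun i => finite_span_coeff_gal ι (Φ i)
  have hpair := cmTypeRank_add_cmTypeRank_eq_of_pair ι e Φ hI h01
  have hcard : Fintype.card I = 2 := by
    classical
    rw [← Finset.card_univ, show (Finset.univ : Finset I) = {i₀, i₁} from Finset.ext fun j => by
      simpa only [Finset.mem_univ, Finset.mem_insert, Finset.mem_singleton, true_iff] using hI j,
      Finset.card_pair h01]
  rw [← Submodule.finrank_eq_zero, IrrOdd.sum_eq_add_of_pair _ hI h01, hcard]
  omega

end Rank

/-! ### §4 The Hodge side -/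

section Hodge

variable {I : Type} [Fintype I] [DecidableEq I] {K : I → Type} [∀ i, Field (K i)] [∀ i, NumberField (K i)]
  [∀ i, IsCMField (K i)] {L : Type} [Field L] [NumberField L] [Normal ℚ L]
  {Φ : ∀ i, CMType (K i)} {A : I → AbelianVariety ℂ} {ιA : ∀ i, 𝓞 (K i) →+* End (A i)}
  {θ : ∀ i, K i →+* Module.End ℂ (complexBetti (A i).X 1)}

/-- **EVERY HODGE CLASS ON EVERY DISJOINT PRODUCT OF COPIES IS A SUM OF PRODUCTS ⟺ THE MATRIX-COEFFICIENT SPACES ARE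
INDEPENDENT.**  Realisations `A_i ⊨ (K_i; Φ_i)`; for all slot maps `π₁, π₂` with disjoint images,
`HodgeClassesProductSpan (⨁ A_{π₁ l}) (⨁ A_{π₂ l})` — iff `iSupIndep MC` on `Gal(L/ℚ)`.
[cite: MoonenZarhin1999LowDim, §3 (3.1)] [cite: Deligne1982HodgeCycles, I.5 (p. 53)] -/
theorem forall_hodgeClassesProductSpan_iff_iSupIndep [Nonempty I] (ι : L →+* ℂ) (e : ∀ i, K i →+* L)
    (hA : ∀ i, IsCMTypeRealisation (Φ i) (A i) (ιA i) (θ i)) :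
    (∀ (N₁ N₂ : ℕ) [NeZero N₁] [NeZero N₂] (π₁ : Fin N₁ → I) (π₂ : Fin N₂ → I), (∀ l₁ l₂, π₁ l₁ ≠ π₂ l₂) →
        HodgeClassesProductSpan (⨁ fun l => A (π₁ l)) (⨁ fun l => A (π₂ l))) ↔
      iSupIndep fun i => Submodule.span ℚ (Set.range fun x : K i →+* L => fun g : L ≃ₐ[ℚ] L =>
        antiVec (Φ i).1 (1 : ℂ ≃+* ℂ) ((ι.comp (g : L →+* L)).comp x)) :=
  (cmFamilyRank_add_card_eq_iff_forall_hodgeClassesProductSpan hA).symm.trans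
    (cmFamilyRank_add_card_eq_iff_iSupIndep ι e Φ)

/-- **A linear dependence among the matrix-coefficient spaces ⟹ a MIXED exceptional Hodge class** on some
`(⨁ A_{π₁ l}) × (⨁ A_{π₂ l})` with disjoint slot maps. [cite: MoonenZarhin1999LowDim, Thm. (0.1) (a) and §3 (3.1)] -/
theorem exists_not_hodgeClassesProductSpan_of_not_iSupIndep [Nonempty I] (ι : L →+* ℂ) (e : ∀ i, K i →+* L)
    (hA : ∀ i, IsCMTypeRealisation (Φ i) (A i) (ιA i) (θ i))
    (hdep : ¬ iSupIndep fun i => Submodule.span ℚ (Set.range fun x : K i →+* L => fun g : L ≃ₐ[ℚ] L =>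
        antiVec (Φ i).1 (1 : ℂ ≃+* ℂ) ((ι.comp (g : L →+* L)).comp x))) :
    ∃ (N₁ N₂ : ℕ) (_ : NeZero N₁) (_ : NeZero N₂) (π₁ : Fin N₁ → I) (π₂ : Fin N₂ → I),
      (∀ l₁ l₂, π₁ l₁ ≠ π₂ l₂) ∧ ¬ HodgeClassesProductSpan (⨁ fun l => A (π₁ l)) (⨁ fun l => A (π₂ l)) :=
  exists_not_hodgeClassesProductSpan_of_cmFamilyRank_add_card_ne hA
    fun h => hdep ((cmFamilyRank_add_card_eq_iff_iSupIndep ι e Φ).1 h)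

/-- Pair form: every Hodge class on every `A₀^a × A₁^b` is a sum of products iff `MC₀ ∩ MC₁ = 0` on `Gal(L/ℚ)` — and
otherwise `dim(MC₀ ∩ MC₁)` is exactly the drop `dim Hg(A₀) + dim Hg(A₁) − dim Hg(A₀ × A₁)`
(`cmTypeRank_add_cmTypeRank_eq_of_pair`). [cite: MoonenZarhin1999LowDim, §3 (3.1)] -/
theorem forall_hodgeClassesProductSpan_pair_iff_inf_eq_bot (ι : L →+* ℂ) (e : ∀ i, K i →+* L)
    (hA : ∀ i, IsCMTypeRealisation (Φ i) (A i) (ιA i) (θ i)) {i₀ i₁ : I} (hI : ∀ j, j = i₀ ∨ j = i₁) (h01 : i₀ ≠ i₁) :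
    (∀ (N₁ N₂ : ℕ) [NeZero N₁] [NeZero N₂] (π₁ : Fin N₁ → I) (π₂ : Fin N₂ → I), (∀ l₁ l₂, π₁ l₁ ≠ π₂ l₂) →
        HodgeClassesProductSpan (⨁ fun l => A (π₁ l)) (⨁ fun l => A (π₂ l))) ↔
      Submodule.span ℚ (Set.range fun x : K i₀ →+* L => fun g : L ≃ₐ[ℚ] L =>
          antiVec (Φ i₀).1 (1 : ℂ ≃+* ℂ) ((ι.comp (g : L →+* L)).comp x)) ⊓
        Submodule.span ℚ (Set.range fun x : K i₁ →+* L => fun g : L ≃ₐ[ℚ] L =>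
          antiVec (Φ i₁).1 (1 : ℂ ≃+* ℂ) ((ι.comp (g : L →+* L)).comp x)) = (⊥ : Submodule ℚ ((L ≃ₐ[ℚ] L) → ℚ)) := by
  haveI : Nonempty I := ⟨i₀⟩
  exact (cmFamilyRank_add_card_eq_iff_forall_hodgeClassesProductSpan hA).symm.trans
    (cmFamilyRank_add_card_eq_iff_inf_eq_bot_of_pair ι e Φ hI h01)

end Hodge

end Literature.AlgebraicGeometry.ComplexMultiplication.IrreducibleOddWeightsRightIdealsCMFields

end
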